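import Literature.Computability.Complexity.KarpChromaticMachine
import Literature.Computability.Complexity.ThreeColouringGraph
import Literature.Computability.Complexity.ThreeColourability
import Literature.Computability.Complexity.NPClosureProofs
import HarnessLib

/-!
# `3SAT ≤ₚ GRAPH 3-COLOURABILITY`, the machine half, and `THREECOL` is NP-complete

GRAPH 3-COLOURABILITY is NP-complete (Stockmeyer 1973; Garey–Johnson–Stockmeyer 1976; Garey–Johnson
[GT4], `K = 3`): membership in `NP` and the textbook reduction from 3SAT (Cormen–Leiserson–Rivest–
Stein, Problem 34-3). `ThreeColouringGraph.lean` proves the equivalence for the palette/OR-gadget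
graph `ThreeColouring.graph L` of a family of slot literals (`colorable_iff_satisfiable`). This file
computes the CODE of that graph from a CNF code in polynomial time, in exactly the architecture of
`KarpChromaticMachine.lean` (whose one-bit bricks on `q = ⟨⟨w, 1ⁱ⟩, 1^{i'}⟩` — `eqClauseF`,
`sameVarF`, `rowPolF`, `colPolF` — and whose reading of the slot literals off a string, `litOf`, are
reused verbatim), and assembles:

* the `FP` map `ThreeColouring.gjsFn : w ↦ ⟨⌜15 r⌝, adjacency bits⟩` (`r` clauses), whose adjacency
  bits are, on EVERY string `w`, the code (`encodingGraphFin`) of the gadget graph of the slot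
  literals READ OFF `w` (`adjBlocksF_eq_encode`), transported to `Fin (5 · (r · 3))` along the block
  numbering `vertexEquiv` (kind-major, then clause, then slot);
* the guarded map `toThreeColFn` (canonical code of a CNF of width `≤ 3` without empty clauses ?
  `gjsFn w` : the non-code `[1]`), `toThreeColFn_mem_FP`;
* **`kSAT_three_karpReducible_THREECOL : kSAT 3 ≤ₚ THREECOL`**;
* `THREECOL_karpReducible_CHROMATIC : THREECOL ≤ₚ CHROMATIC` (`w ↦ ⟨w, ⌜3⌝⟩`), hence
  `THREECOL_mem_NP` from `ChromaticNP.CHROMATIC_mem_NP` and the closure of `NP` under `≤ₚ`;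
* **`THREECOL_isNPComplete : IsNPComplete THREECOL`** from the tree's `isNPComplete_kSAT_three_holds`
  (Arora–Barak Thm. 2.10 (2)) and `IsComplete.of_reducible_holds`.

## The machine (brick algebra; no machine is written)

As in `KarpChromaticMachine.lean`: the adjacency matrix is emitted kind-block by kind-block, a row
`(κ, i, j)` by a counted fold over the clause index of the column, every bit being a one-bit brick
on `q = ⟨⟨w, 1ⁱ⟩, 1^{i'}⟩` (string equality of unary clause indices, equality of the values of two
variable numerals, a polarity bit, and Lean-level constants in the positions `j, j'` and the kinds).

## References

* [CLRS2009] T. H. Cormen, C. E. Leiserson, R. L. Rivest, C. Stein, *Introduction to Algorithms*,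
  3rd ed. (2009), Problem 34-3 (3-COLOR is NP-complete via 3-CNF-SAT).
* [Stockmeyer1973] L. J. Stockmeyer, *Planar 3-colorability is polynomial complete*, ACM SIGACT
  News 5:3 (1973) 19–25.
* [GareyJohnson1979] M. R. Garey, D. S. Johnson, *Computers and Intractability* (1979), A1.1 [GT4].
* [AroraBarakCC2009] S. Arora, B. Barak, *Computational Complexity*, CUP 2009, §1.3 (polynomial
  time is closed under composition and bounded loops), §0.1 (adjacency matrices), Thm. 2.8,
  Thm. 2.10 (2).
-/

noncomputable section

namespace Literature.Computability.Complexity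

namespace ThreeColouring

open _root_.Computability Polynomial Brick HashBricks NegCNF Ladder3 Plumb OneInThree
open scoped Notation
open KarpChromatic (Slot slotLit colArg eqClauseF sameVarF rowPolF colPolF colFoldInit blockFoldInit
  litOf qArg rOf rOf_le length_ccat_const ofFn_finProd ccat_eq_flatten_ofFn ofFn_three rOf_encode
  litOf_encode guard3F guard3F_encode guard3F_of_not_canon threeRF colArg_mem_FP eqClauseF_mem_FP
  sameVarF_mem_FP rowPolF_mem_FP colPolF_mem_FP colFoldInit_mem_FP blockFoldInit_mem_FP
  guard3F_mem_FP threeRF_mem_FP eqClauseF_qArg sameVarF_qArg rowPolF_qArg colPolF_qArg fstF_qArg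
  colArg_qArg slotOfClause)

/-! ### The bit bricks on `q = ⟨⟨w, 1ⁱ⟩, 1^{i'}⟩` -/

/-- **The adjacency bit** of row vertex `(κ, i, j)` and column vertex `(κ', i', j')`, as a brick on
`q` (the arcs of `ThreeColouring.Adj`; `eqClauseF = [i = i']`, `sameVarF j j'` = equality of the
variable numerals of the two slots, `rowPolF j` / `colPolF j'` = the polarity bits).
[cite: CLRS2009, Problem 34-3 (3-COLOR via 3-CNF-SAT)] -/
def bitF : Kind → ℕ → Kind → ℕ → (List Bool → List Bool)
  | Kind.pal, j, Kind.pal, j' => fun _ => [decide (j ≠ j')]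
  | Kind.pos, _, Kind.pal, j' => fun _ => [decide (j' = 2)]
  | Kind.pal, j, Kind.pos, _ => fun _ => [decide (j = 2)]
  | Kind.neg, _, Kind.pal, j' => fun _ => [decide (j' = 2)]
  | Kind.pal, j, Kind.neg, _ => fun _ => [decide (j = 2)]
  | Kind.pos, j, Kind.neg, j' => sameVarF j j'
  | Kind.neg, j, Kind.pos, j' => sameVarF j j'
  | Kind.lo, j, Kind.lo, j' => andFn eqClauseF fun _ => [decide (j ≠ j')]
  | Kind.hi, j, Kind.hi, j' => andFn eqClauseF fun _ => [decide (j ≠ j')]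
  | Kind.lo, j, Kind.pos, j' => andFn (fun _ => [decide (j = j' ∧ j ≠ 2)]) (andFn eqClauseF (colPolF j'))
  | Kind.pos, j, Kind.lo, j' => andFn (fun _ => [decide (j' = j ∧ j' ≠ 2)]) (andFn eqClauseF (rowPolF j))
  | Kind.lo, j, Kind.neg, j' =>
      andFn (fun _ => [decide (j = j' ∧ j ≠ 2)]) (andFn eqClauseF (notFn (colPolF j')))
  | Kind.neg, j, Kind.lo, j' =>
      andFn (fun _ => [decide (j' = j ∧ j' ≠ 2)]) (andFn eqClauseF (notFn (rowPolF j)))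
  | Kind.hi, j, Kind.lo, j' => andFn (fun _ => [decide (j = 0 ∧ j' = 2)]) eqClauseF
  | Kind.lo, j, Kind.hi, j' => andFn (fun _ => [decide (j' = 0 ∧ j = 2)]) eqClauseF
  | Kind.hi, j, Kind.pos, j' => andFn (fun _ => [decide (j = 1 ∧ j' = 2)]) (andFn eqClauseF (colPolF j'))
  | Kind.pos, j, Kind.hi, j' => andFn (fun _ => [decide (j' = 1 ∧ j = 2)]) (andFn eqClauseF (rowPolF j))
  | Kind.hi, j, Kind.neg, j' =>
      andFn (fun _ => [decide (j = 1 ∧ j' = 2)]) (andFn eqClauseF (notFn (colPolF j')))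
  | Kind.neg, j, Kind.hi, j' =>
      andFn (fun _ => [decide (j' = 1 ∧ j = 2)]) (andFn eqClauseF (notFn (rowPolF j)))
  | Kind.hi, j, Kind.pal, j' => fun _ => [decide (j = 2 ∧ j' ≠ 0)]
  | Kind.pal, j, Kind.hi, j' => fun _ => [decide (j' = 2 ∧ j ≠ 0)]
  | _, _, _, _ => fun _ => [false]

/-- The three bits of the column slots `(i', 0), (i', 1), (i', 2)` of kind `κ'`. [folklore] -/
def tripleF (κ : Kind) (j : ℕ) (κ' : Kind) : List Bool → List Bool :=
  fun q => bitF κ j κ' 0 q ++ bitF κ j κ' 1 q ++ bitF κ j κ' 2 q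

/-! ### Rows, groups, blocks -/

/-- **The inner fold**: the `3r` bits of the columns of kind `κ'`, by `Brick.foldLoop appF (clipF 3 _) X`
(on the initial record `KarpChromatic.colFoldInit`). [cite: AroraBarakCC2009, §1.3 (bounded loops)] -/
def innerF (κ : Kind) (j : ℕ) (κ' : Kind) : List Bool → List Bool :=
  sndPow 2 ∘ foldLoop appF (clipF 3 (tripleF κ j κ')) X ∘ colFoldInit
/-- **A row**: the five column blocks. [folklore] -/
def rowF (κ : Kind) (j : ℕ) : List Bool → List Bool :=
  fun a => innerF κ j Kind.pal a ++ innerF κ j Kind.pos a ++ innerF κ j Kind.neg a ++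
    innerF κ j Kind.lo a ++ innerF κ j Kind.hi a
/-- **A group**: the three rows `j = 0, 1, 2` of clause `i`. [folklore] -/
def groupF (κ : Kind) : List Bool → List Bool := fun a => rowF κ 0 a ++ rowF κ 1 a ++ rowF κ 2 a
/-- The clip constant of the outer folds (`45 r ≤ 45 (|w| + 1)` bits per group). [folklore] -/
def Cblk : ℕ := 45
/-- **A block**: the rows of kind `κ`, by `Brick.foldLoop appF (clipF Cblk (groupF κ)) X`.
[cite: AroraBarakCC2009, §1.3 (bounded loops)] -/
def blockF (κ : Kind) : List Bool → List Bool := sndPow 2 ∘ foldLoop appF (clipF Cblk (groupF κ)) X ∘ blockFoldInit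
/-- **The adjacency bits**: the five blocks. [cite: CLRS2009, Problem 34-3 (3-COLOR via 3-CNF-SAT)] -/
def adjBlocksF : List Bool → List Bool := fun w =>
  blockF Kind.pal w ++ blockF Kind.pos w ++ blockF Kind.neg w ++ blockF Kind.lo w ++ blockF Kind.hi w

/-! ### Numerals, the map, the guard -/

/-- `⌜5 (3 r)⌝`, the number of vertices. [folklore] -/
def vertexNumF : List Bool → List Bool := prodFn ∘ fanoutFn (fun _ => encodeNat 5) threeRF
/-- **The map on codes**: `w ↦ ⟨⌜15 r⌝, adjacency bits⟩`. [cite: CLRS2009, Problem 34-3 (3-COLOR via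
3-CNF-SAT)] -/
def gjsFn : List Bool → List Bool := fanoutFn vertexNumF adjBlocksF
/-- **The reduction `3SAT → GRAPH 3-COLOURABILITY` on strings**: the map on guarded codes
(`KarpChromatic.guard3F`: canonical code, width `≤ 3`, no empty clause), the non-code `[1]`
otherwise. [cite: CLRS2009, Problem 34-3 (3-COLOR via 3-CNF-SAT)] -/
def toThreeColFn : List Bool → List Bool := iteFn guard3F gjsFn fun _ => [true]

/-! ### Membership in `FP` -/

/-- A constant-guarded conjunction is in `FP`. [cite: AroraBarakCC2009, §1.3] -/
theorem andConst_mem_FP (b : Bool) {f : List Bool → List Bool} (hf : f ∈ FP) : andFn (fun _ => [b]) f ∈ FP :=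
  andFn_mem_FP (const_mem_FP _) hf

/-- **Every adjacency bit is in `FP`.** [cite: AroraBarakCC2009, §1.3] -/
theorem bitF_mem_FP : ∀ (κ : Kind) (j : ℕ) (κ' : Kind) (j' : ℕ), bitF κ j κ' j' ∈ FP
  | Kind.pal, _, Kind.pal, _ => const_mem_FP _
  | Kind.pal, _, Kind.pos, _ => const_mem_FP _
  | Kind.pal, _, Kind.neg, _ => const_mem_FP _
  | Kind.pal, _, Kind.lo, _ => const_mem_FP _
  | Kind.pal, _, Kind.hi, _ => const_mem_FP _
  | Kind.pos, _, Kind.pal, _ => const_mem_FP _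
  | Kind.pos, _, Kind.pos, _ => const_mem_FP _
  | Kind.pos, _, Kind.neg, _ => sameVarF_mem_FP _ _
  | Kind.pos, _, Kind.lo, _ => andConst_mem_FP _ (andFn_mem_FP eqClauseF_mem_FP (rowPolF_mem_FP _))
  | Kind.pos, _, Kind.hi, _ => andConst_mem_FP _ (andFn_mem_FP eqClauseF_mem_FP (rowPolF_mem_FP _))
  | Kind.neg, _, Kind.pal, _ => const_mem_FP _
  | Kind.neg, _, Kind.pos, _ => sameVarF_mem_FP _ _
  | Kind.neg, _, Kind.neg, _ => const_mem_FP _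
  | Kind.neg, _, Kind.lo, _ =>
      andConst_mem_FP _ (andFn_mem_FP eqClauseF_mem_FP (notFn_mem_FP (rowPolF_mem_FP _)))
  | Kind.neg, _, Kind.hi, _ =>
      andConst_mem_FP _ (andFn_mem_FP eqClauseF_mem_FP (notFn_mem_FP (rowPolF_mem_FP _)))
  | Kind.lo, _, Kind.pal, _ => const_mem_FP _
  | Kind.lo, _, Kind.pos, _ => andConst_mem_FP _ (andFn_mem_FP eqClauseF_mem_FP (colPolF_mem_FP _))
  | Kind.lo, _, Kind.neg, _ =>
      andConst_mem_FP _ (andFn_mem_FP eqClauseF_mem_FP (notFn_mem_FP (colPolF_mem_FP _)))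
  | Kind.lo, _, Kind.lo, _ => andFn_mem_FP eqClauseF_mem_FP (const_mem_FP _)
  | Kind.lo, _, Kind.hi, _ => andConst_mem_FP _ eqClauseF_mem_FP
  | Kind.hi, _, Kind.pal, _ => const_mem_FP _
  | Kind.hi, _, Kind.pos, _ => andConst_mem_FP _ (andFn_mem_FP eqClauseF_mem_FP (colPolF_mem_FP _))
  | Kind.hi, _, Kind.neg, _ =>
      andConst_mem_FP _ (andFn_mem_FP eqClauseF_mem_FP (notFn_mem_FP (colPolF_mem_FP _)))
  | Kind.hi, _, Kind.lo, _ => andConst_mem_FP _ eqClauseF_mem_FP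
  | Kind.hi, _, Kind.hi, _ => andFn_mem_FP eqClauseF_mem_FP (const_mem_FP _)

/-- `tripleF κ j κ' ∈ FP`. [cite: AroraBarakCC2009, §1.3] -/
theorem tripleF_mem_FP (κ : Kind) (j : ℕ) (κ' : Kind) : tripleF κ j κ' ∈ FP :=
  append_mem_FP (append_mem_FP (bitF_mem_FP κ j κ' 0) (bitF_mem_FP κ j κ' 1)) (bitF_mem_FP κ j κ' 2)
/-- **`innerF κ j κ' ∈ FP`** (`foldLoop_clipF_mem_FP`). [cite: AroraBarakCC2009, §1.3 (bounded loops)] -/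
theorem innerF_mem_FP (κ : Kind) (j : ℕ) (κ' : Kind) : innerF κ j κ' ∈ FP :=
  comp_mem_FP (sndPow_mem_FP 2) (comp_mem_FP
    (foldLoop_clipF_mem_FP 3 appF_mem_FP length_appF_le (tripleF_mem_FP κ j κ') _) colFoldInit_mem_FP)
/-- `rowF κ j ∈ FP`. [cite: AroraBarakCC2009, §1.3] -/
theorem rowF_mem_FP (κ : Kind) (j : ℕ) : rowF κ j ∈ FP :=
  append_mem_FP (append_mem_FP (append_mem_FP (append_mem_FP (innerF_mem_FP κ j _) (innerF_mem_FP κ j _))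
    (innerF_mem_FP κ j _)) (innerF_mem_FP κ j _)) (innerF_mem_FP κ j _)
/-- `groupF κ ∈ FP`. [cite: AroraBarakCC2009, §1.3] -/
theorem groupF_mem_FP (κ : Kind) : groupF κ ∈ FP :=
  append_mem_FP (append_mem_FP (rowF_mem_FP κ 0) (rowF_mem_FP κ 1)) (rowF_mem_FP κ 2)
/-- **`blockF κ ∈ FP`** (`foldLoop_clipF_mem_FP`). [cite: AroraBarakCC2009, §1.3 (bounded loops)] -/
theorem blockF_mem_FP (κ : Kind) : blockF κ ∈ FP :=
  comp_mem_FP (sndPow_mem_FP 2) (comp_mem_FP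
    (foldLoop_clipF_mem_FP Cblk appF_mem_FP length_appF_le (groupF_mem_FP κ) _) blockFoldInit_mem_FP)
/-- **`adjBlocksF ∈ FP`.** [cite: AroraBarakCC2009, §1.3] -/
theorem adjBlocksF_mem_FP : adjBlocksF ∈ FP :=
  append_mem_FP (append_mem_FP (append_mem_FP (append_mem_FP (blockF_mem_FP _) (blockF_mem_FP _))
    (blockF_mem_FP _)) (blockF_mem_FP _)) (blockF_mem_FP _)
/-- `vertexNumF ∈ FP`. [cite: AroraBarakCC2009, §1.3] -/
theorem vertexNumF_mem_FP : vertexNumF ∈ FP :=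
  comp_mem_FP prodFn_mem_FP (fanoutFn_mem_FP (const_mem_FP _) threeRF_mem_FP)
/-- **`gjsFn ∈ FP`.** [cite: AroraBarakCC2009, Thm. 2.8] -/
theorem gjsFn_mem_FP : gjsFn ∈ FP := fanoutFn_mem_FP vertexNumF_mem_FP adjBlocksF_mem_FP
/-- **`toThreeColFn ∈ FP`.** [cite: AroraBarakCC2009, Thm. 2.8] -/
theorem toThreeColFn_mem_FP : toThreeColFn ∈ FP := iteFn_mem_FP guard3F_mem_FP gjsFn_mem_FP (const_mem_FP _)

/-! ### Values of the bits on a genuine argument `q = ⟨⟨w, 1ⁱ⟩, 1^{i'}⟩` -/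

/-- **The Boolean value of the adjacency bit** of `(κ, i, j)` and `(κ', i', j')` read off `w` (the
table of `ThreeColouring.Adj` on the slot literals `KarpChromatic.litOf w`). [cite: CLRS2009,
Problem 34-3 (3-COLOR via 3-CNF-SAT)] -/
def bitVal (w : List Bool) : Kind → ℕ → Kind → ℕ → ℕ → ℕ → Bool
  | Kind.pal, j, Kind.pal, j', _, _ => decide (j ≠ j')
  | Kind.pos, _, Kind.pal, j', _, _ => decide (j' = 2)
  | Kind.pal, j, Kind.pos, _, _, _ => decide (j = 2)
  | Kind.neg, _, Kind.pal, j', _, _ => decide (j' = 2)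
  | Kind.pal, j, Kind.neg, _, _, _ => decide (j = 2)
  | Kind.pos, j, Kind.neg, j', i, i' => decide ((litOf w i j).1 = (litOf w i' j').1)
  | Kind.neg, j, Kind.pos, j', i, i' => decide ((litOf w i j).1 = (litOf w i' j').1)
  | Kind.lo, j, Kind.lo, j', i, i' => decide (i = i') && decide (j ≠ j')
  | Kind.hi, j, Kind.hi, j', i, i' => decide (i = i') && decide (j ≠ j')
  | Kind.lo, j, Kind.pos, j', i, i' => decide (j = j' ∧ j ≠ 2) && (decide (i = i') && (litOf w i' j').2)
  | Kind.pos, j, Kind.lo, j', i, i' => decide (j' = j ∧ j' ≠ 2) && (decide (i = i') && (litOf w i j).2)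
  | Kind.lo, j, Kind.neg, j', i, i' => decide (j = j' ∧ j ≠ 2) && (decide (i = i') && !(litOf w i' j').2)
  | Kind.neg, j, Kind.lo, j', i, i' => decide (j' = j ∧ j' ≠ 2) && (decide (i = i') && !(litOf w i j).2)
  | Kind.hi, j, Kind.lo, j', i, i' => decide (j = 0 ∧ j' = 2) && decide (i = i')
  | Kind.lo, j, Kind.hi, j', i, i' => decide (j' = 0 ∧ j = 2) && decide (i = i')
  | Kind.hi, j, Kind.pos, j', i, i' => decide (j = 1 ∧ j' = 2) && (decide (i = i') && (litOf w i' j').2)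
  | Kind.pos, j, Kind.hi, j', i, i' => decide (j' = 1 ∧ j = 2) && (decide (i = i') && (litOf w i j).2)
  | Kind.hi, j, Kind.neg, j', i, i' => decide (j = 1 ∧ j' = 2) && (decide (i = i') && !(litOf w i' j').2)
  | Kind.neg, j, Kind.hi, j', i, i' => decide (j' = 1 ∧ j = 2) && (decide (i = i') && !(litOf w i j).2)
  | Kind.hi, j, Kind.pal, j', _, _ => decide (j = 2 ∧ j' ≠ 0)
  | Kind.pal, j, Kind.hi, j', _, _ => decide (j' = 2 ∧ j ≠ 0)
  | _, _, _, _, _, _ => false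

/-- **Value of the adjacency bit brick** on a genuine argument. [folklore] -/
theorem bitF_qArg (w : List Bool) (i i' : ℕ) : ∀ (κ : Kind) (j : ℕ) (κ' : Kind) (j' : ℕ),
    bitF κ j κ' j' (qArg w i i') = [bitVal w κ j κ' j' i i']
  | Kind.pal, _, Kind.pal, _ => rfl
  | Kind.pal, _, Kind.pos, _ => rfl
  | Kind.pal, _, Kind.neg, _ => rfl
  | Kind.pal, _, Kind.lo, _ => rfl
  | Kind.pal, _, Kind.hi, _ => rfl
  | Kind.pos, _, Kind.pal, _ => rfl
  | Kind.pos, _, Kind.pos, _ => rfl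
  | Kind.pos, j, Kind.neg, j' => sameVarF_qArg j j' w i i'
  | Kind.pos, j, Kind.lo, _ => andFn_apply rfl (andFn_apply (eqClauseF_qArg w i i') (rowPolF_qArg j w i i'))
  | Kind.pos, j, Kind.hi, _ => andFn_apply rfl (andFn_apply (eqClauseF_qArg w i i') (rowPolF_qArg j w i i'))
  | Kind.neg, _, Kind.pal, _ => rfl
  | Kind.neg, j, Kind.pos, j' => sameVarF_qArg j j' w i i'
  | Kind.neg, _, Kind.neg, _ => rfl
  | Kind.neg, j, Kind.lo, _ =>
      andFn_apply rfl (andFn_apply (eqClauseF_qArg w i i') (notFn_apply (rowPolF_qArg j w i i')))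
  | Kind.neg, j, Kind.hi, _ =>
      andFn_apply rfl (andFn_apply (eqClauseF_qArg w i i') (notFn_apply (rowPolF_qArg j w i i')))
  | Kind.lo, _, Kind.pal, _ => rfl
  | Kind.lo, _, Kind.pos, j' => andFn_apply rfl (andFn_apply (eqClauseF_qArg w i i') (colPolF_qArg j' w i i'))
  | Kind.lo, _, Kind.neg, j' =>
      andFn_apply rfl (andFn_apply (eqClauseF_qArg w i i') (notFn_apply (colPolF_qArg j' w i i')))
  | Kind.lo, _, Kind.lo, _ => andFn_apply (eqClauseF_qArg w i i') rfl
  | Kind.lo, _, Kind.hi, _ => andFn_apply rfl (eqClauseF_qArg w i i')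
  | Kind.hi, _, Kind.pal, _ => rfl
  | Kind.hi, _, Kind.pos, j' => andFn_apply rfl (andFn_apply (eqClauseF_qArg w i i') (colPolF_qArg j' w i i'))
  | Kind.hi, _, Kind.neg, j' =>
      andFn_apply rfl (andFn_apply (eqClauseF_qArg w i i') (notFn_apply (colPolF_qArg j' w i i')))
  | Kind.hi, _, Kind.lo, _ => andFn_apply rfl (eqClauseF_qArg w i i')
  | Kind.hi, _, Kind.hi, _ => andFn_apply (eqClauseF_qArg w i i') rfl

/-- **Value of the triple** on a genuine argument: three bits. [folklore] -/
theorem tripleF_qArg (κ : Kind) (j : ℕ) (κ' : Kind) (w : List Bool) (i i' : ℕ) :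
    tripleF κ j κ' (qArg w i i') = [bitVal w κ j κ' 0 i i', bitVal w κ j κ' 1 i i', bitVal w κ j κ' 2 i i'] := by
  simp [tripleF, bitF_qArg w i i']

/-! ### Values of the folds -/

/-- The `3r` bits of the columns of kind `κ'` in row `(κ, i, j)`. [folklore] -/
def colBits (w : List Bool) (κ : Kind) (j : ℕ) (κ' : Kind) (i : ℕ) : List Bool :=
  ccat (fun i' => [bitVal w κ j κ' 0 i i', bitVal w κ j κ' 1 i i', bitVal w κ j κ' 2 i i']) (rOf w)
/-- The row of vertex `(κ, i, j)`. [folklore] -/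
def rowBits (w : List Bool) (κ : Kind) (j i : ℕ) : List Bool :=
  colBits w κ j Kind.pal i ++ colBits w κ j Kind.pos i ++ colBits w κ j Kind.neg i ++
    colBits w κ j Kind.lo i ++ colBits w κ j Kind.hi i
/-- The three rows of clause `i` in block `κ`. [folklore] -/
def groupBits (w : List Bool) (κ : Kind) (i : ℕ) : List Bool :=
  rowBits w κ 0 i ++ rowBits w κ 1 i ++ rowBits w κ 2 i
/-- The block of kind `κ`. [folklore] -/
def blockBits (w : List Bool) (κ : Kind) : List Bool := ccat (groupBits w κ) (rOf w)
/-- **The adjacency bits read off `w`** (the value of `adjBlocksF`, `adjBlocksF_apply`). [folklore] -/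
def adjBits (w : List Bool) : List Bool :=
  blockBits w Kind.pal ++ blockBits w Kind.pos ++ blockBits w Kind.neg ++ blockBits w Kind.lo ++
    blockBits w Kind.hi

/-- `|colBits| = 3r`. [folklore] -/
theorem length_colBits (w : List Bool) (κ : Kind) (j : ℕ) (κ' : Kind) (i : ℕ) :
    (colBits w κ j κ' i).length = rOf w * 3 := by
  unfold colBits
  exact length_ccat_const (b := 3) (fun _ => rfl) _
/-- `|rowBits| = 15r`. [folklore] -/
theorem length_rowBits (w : List Bool) (κ : Kind) (j i : ℕ) : (rowBits w κ j i).length = 5 * (rOf w * 3) := by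
  simp only [rowBits, List.length_append, length_colBits]; ring
/-- `|groupBits| = 45r`. [folklore] -/
theorem length_groupBits (w : List Bool) (κ : Kind) (i : ℕ) : (groupBits w κ i).length = 3 * (5 * (rOf w * 3)) := by
  simp only [groupBits, List.length_append, length_rowBits]; ring
/-- `|blockBits| = r · 45r`. [folklore] -/
theorem length_blockBits (w : List Bool) (κ : Kind) : (blockBits w κ).length = rOf w * (3 * (5 * (rOf w * 3))) :=
  length_ccat_const (length_groupBits w κ) _
/-- `|adjBits| = (15 r)²`. [folklore] -/
theorem length_adjBits (w : List Bool) : (adjBits w).length = (5 * (rOf w * 3)) * (5 * (rOf w * 3)) := by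
  simp only [adjBits, List.length_append, length_blockBits]; ring

/-- **Value of the inner fold** on a genuine argument `a = ⟨w, 1ⁱ⟩`. [folklore] -/
theorem innerF_boolPair (κ : Kind) (j : ℕ) (κ' : Kind) (w : List Bool) (i : ℕ) :
    innerF κ j κ' (boolPair w (ones i)) = colBits w κ j κ' i := by
  have hinit : colFoldInit (boolPair w (ones i)) =
      boolPair (boolPair w (ones i)) (boolPair (encodeNat (rOf w)) (boolPair (ones 0) [])) := by
    simp [KarpChromatic.colFoldInit, fanoutFn_apply, KarpChromatic.rOf]
  have hk : rOf w ≤ X.eval (boolPair w (ones i)).length := by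
    rw [eval_X, length_boolPair]; have := rOf_le w; omega
  rw [innerF, Function.comp_apply, Function.comp_apply, hinit, foldLoop_apply _ _ hk, sndPow_succ_boolPair,
    sndPow_succ_boolPair, sndPow_zero_boolPair, foldAcc_clipF, foldAcc_appF, List.nil_append]
  · unfold colBits
    refine ccat_congr fun i' _ => ?_
    rw [Nat.zero_add]
    exact tripleF_qArg κ j κ' w i i'
  · intro i' _ _
    rw [show boolPair (boolPair w (ones i)) (ones i') = qArg w i i' from rfl, tripleF_qArg]
    simp only [List.length_cons, List.length_nil]
    omega

/-- **Value of a row** on `a = ⟨w, 1ⁱ⟩`. [folklore] -/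
theorem rowF_boolPair (κ : Kind) (j : ℕ) (w : List Bool) (i : ℕ) : rowF κ j (boolPair w (ones i)) = rowBits w κ j i := by
  simp only [rowF, innerF_boolPair, rowBits]

/-- **Value of a group** on `a = ⟨w, 1ⁱ⟩`. [folklore] -/
theorem groupF_boolPair (κ : Kind) (w : List Bool) (i : ℕ) : groupF κ (boolPair w (ones i)) = groupBits w κ i := by
  simp only [groupF, rowF_boolPair, groupBits]

/-- **Value of a block** (unclipping: a group has `45 r ≤ 45 (|w| + 1)` bits). [folklore] -/
theorem blockF_apply (κ : Kind) (w : List Bool) : blockF κ w = blockBits w κ := by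
  have hinit : blockFoldInit w = boolPair w (boolPair (encodeNat (rOf w)) (boolPair (ones 0) [])) := by
    simp [KarpChromatic.blockFoldInit, fanoutFn_apply, KarpChromatic.rOf]
  have hk : rOf w ≤ X.eval w.length := by rw [eval_X]; exact rOf_le w
  rw [blockF, Function.comp_apply, Function.comp_apply, hinit, foldLoop_apply _ _ hk, sndPow_succ_boolPair,
    sndPow_succ_boolPair, sndPow_zero_boolPair, foldAcc_clipF, foldAcc_appF, List.nil_append]
  · unfold blockBits
    refine ccat_congr fun i _ => ?_
    rw [Nat.zero_add, groupF_boolPair]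
  · intro i _ _
    rw [groupF_boolPair, length_groupBits, Cblk]
    have := rOf_le w
    nlinarith

/-- **Value of the adjacency bricks on every string**: `adjBlocksF w = adjBits w`. [folklore] -/
theorem adjBlocksF_apply (w : List Bool) : adjBlocksF w = adjBits w := by
  simp only [adjBlocksF, blockF_apply, adjBits]

/-! ### The adjacency bits are the code of the gadget graph of the slot literals read off `w` -/

/-- The slot literals read off `w`, as a family indexed by the slots of `r = |fstF w|` clauses
(= `KarpChromatic.litFamily w`). [folklore] -/
def litFamily (w : List Bool) : Slot (rOf w) → Literal ℕ := fun p => litOf w p.1 p.2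

/-- **The block numbering of the vertices**: `t = τ (3r) + (3 i + j) ↦ (kind τ, (i, j))` (kind-major,
`Fin 5 × (Fin r × Fin 3)` through `finProdFinEquiv` twice and `kindEquiv`). [folklore] -/
def vertexEquiv (r : ℕ) : Fin (5 * (r * 3)) ≃ Vtx r :=
  finProdFinEquiv.symm.trans (Equiv.prodCongr kindEquiv finProdFinEquiv.symm)

/-- `vertexEquiv` on a block-numbered index. [folklore] -/
theorem vertexEquiv_apply (r : ℕ) (τ : Fin 5) (i : Fin r) (j : Fin 3) :
    vertexEquiv r (finProdFinEquiv (τ, finProdFinEquiv (i, j))) = (kindEquiv τ, (i, j)) := by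
  simp [vertexEquiv]

/-- **The gadget graph of the slot literals read off `w`, on the vertex set `Fin (15 r)`.**
[cite: CLRS2009, Problem 34-3 (3-COLOR via 3-CNF-SAT)] -/
def graphOfCode (w : List Bool) : SimpleGraph (Fin (5 * (rOf w * 3))) :=
  (graph (litFamily w)).comap (vertexEquiv (rOf w))

/-- `graphOfCode w` is isomorphic to the gadget graph of `litFamily w`. [folklore] -/
def graphOfCodeIso (w : List Bool) : graphOfCode w ≃g graph (litFamily w) :=
  SimpleGraph.Iso.comap (vertexEquiv (rOf w)) (graph (litFamily w))

/-- **The adjacency bit is the table of `ThreeColouring.Adj`.** [cite: CLRS2009, Problem 34-3 (3-COLOR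
via 3-CNF-SAT)] -/
theorem decide_adj_eq_bitVal (w : List Bool) (κ κ' : Kind) (i i' : Fin (rOf w)) (j j' : Fin 3) :
    @decide (Adj (litFamily w) (κ, (i, j)) (κ', (i', j'))) (Classical.propDecidable _) =
      bitVal w κ j κ' j' i i' := by
  rw [Bool.eq_iff_iff, @Bool.decide_iff _ (Classical.propDecidable _)]
  cases κ <;> cases κ' <;> simp only [Adj, bitVal, litFamily] <;>
    simp [Fin.ext_iff, -Fin.val_eq_zero_iff, @eq_comm ℕ (i' : ℕ) (i : ℕ)] <;> tauto

/-- `List.ofFn` over the block-numbered vertex set, block by block. [folklore] -/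
theorem ofFn_vertices {α : Type} {r : ℕ} (h : Fin (5 * (r * 3)) → α) :
    List.ofFn h = (List.ofFn fun τ : Fin 5 => (List.ofFn fun i : Fin r => List.ofFn fun j : Fin 3 =>
      h (finProdFinEquiv (τ, finProdFinEquiv (i, j)))).flatten).flatten := by
  have h1 : List.ofFn h = List.ofFn (fun u : Fin (5 * (r * 3)) => (h ∘ finProdFinEquiv) (finProdFinEquiv.symm u)) :=
    congrArg List.ofFn (funext fun u => by rw [Function.comp_apply, Equiv.apply_symm_apply])
  rw [h1, ofFn_finProd]
  refine congrArg List.flatten (congrArg List.ofFn (funext fun τ => ?_))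
  show (List.ofFn fun b : Fin (r * 3) => (h ∘ finProdFinEquiv) (τ, b)) = _
  have h2 : (List.ofFn fun b : Fin (r * 3) => (h ∘ finProdFinEquiv) (τ, b)) =
      List.ofFn (fun u : Fin (r * 3) => (h ∘ finProdFinEquiv ∘ Prod.mk τ ∘ finProdFinEquiv) (finProdFinEquiv.symm u)) :=
    congrArg List.ofFn (funext fun b => by simp only [Function.comp_apply, Equiv.apply_symm_apply])
  rw [h2, ofFn_finProd]
  rfl

/-- `List.ofFn` over `Fin 5`. [folklore] -/
theorem ofFn_five {α : Type} (f : Fin 5 → α) : List.ofFn f = [f 0, f 1, f 2, f 3, f 4] := by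
  simp [List.ofFn_succ]

/-- The adjacency table of `graphOfCode w` as a Boolean function of a pair of vertices (classical
decidability, as in `encodingGraphFin`). [folklore] -/
def adjDec (w : List Bool) : Fin (5 * (rOf w * 3)) × Fin (5 * (rOf w * 3)) → Bool :=
  fun p => @decide ((graphOfCode w).Adj p.1 p.2) (Classical.propDecidable _)

/-- **The adjacency bits read off `w` are the code of `graphOfCode w`.** [cite: AroraBarakCC2009,
§0.1 (adjacency matrix)] -/
theorem adjBits_eq_encode (w : List Bool) : adjBits w = (encodingGraphFin _).encode (graphOfCode w) := by
  -- the bits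
  have hbit : ∀ (τ : Fin 5) (i : Fin (rOf w)) (j : Fin 3) (τ' : Fin 5) (i' : Fin (rOf w)) (j' : Fin 3),
      adjDec w (finProdFinEquiv (τ, finProdFinEquiv (i, j)), finProdFinEquiv (τ', finProdFinEquiv (i', j'))) =
      bitVal w (kindEquiv τ) j (kindEquiv τ') j' i i' := by
    intro τ i j τ' i' j'
    rw [adjDec, ← decide_adj_eq_bitVal, @decide_eq_decide _ _ (Classical.propDecidable _) (Classical.propDecidable _)]
    simp only [graphOfCode, SimpleGraph.comap_adj, vertexEquiv_apply, graph_adj]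
  -- the rows
  have hrow : ∀ (τ : Fin 5) (i : Fin (rOf w)) (j : Fin 3),
      (List.ofFn fun b : Fin (5 * (rOf w * 3)) => adjDec w (finProdFinEquiv (τ, finProdFinEquiv (i, j)), b)) =
      rowBits w (kindEquiv τ) j i := by
    intro τ i j
    rw [ofFn_vertices]
    simp only [hbit, ofFn_five, ofFn_three, kindEquiv_zero, kindEquiv_one, kindEquiv_two, kindEquiv_three,
      kindEquiv_four, List.flatten_cons, List.flatten_nil, List.append_nil, rowBits, colBits, ccat_eq_flatten_ofFn,
      List.append_assoc, Fin.val_zero, Fin.val_one, Fin.val_two]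
  rw [ChromaticNP.encodingGraphFin_encode_eq]
  change adjBits w = List.ofFn (fun t : Fin (_ * _) => adjDec w (finProdFinEquiv.symm t))
  rw [ofFn_finProd, ofFn_vertices]
  simp only [List.flatten_flatten, List.flatten_append, List.map_ofFn, Function.comp_def, hrow, ofFn_five, ofFn_three,
    kindEquiv_zero, kindEquiv_one, kindEquiv_two, kindEquiv_three, kindEquiv_four, List.flatten_cons,
    List.flatten_nil, List.append_nil, adjBits, blockBits, groupBits, ccat_eq_flatten_ofFn, List.append_assoc,
    Fin.val_zero, Fin.val_one, Fin.val_two]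

/-- **`adjBlocksF w` is the code of `graphOfCode w`, on every string `w`.** [cite: CLRS2009, Problem 34-3
(3-COLOR via 3-CNF-SAT)] -/
theorem adjBlocksF_eq_encode (w : List Bool) : adjBlocksF w = (encodingGraphFin _).encode (graphOfCode w) := by
  rw [adjBlocksF_apply, adjBits_eq_encode]

/-! ### On a code, the graph read off is the gadget graph of the CNF -/

/-- Colourability of the gadget graph depends only on the slot literals (transport along `r = r'`).
[folklore] -/
theorem colorable_graph_congr {r r' : ℕ} (h : r = r') {L : Slot r → Literal ℕ} {L' : Slot r' → Literal ℕ}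
    (hL : ∀ (i : Fin r) (j : Fin 3), L (i, j) = L' (Fin.cast h i, j)) (k : ℕ) :
    (graph L).Colorable k ↔ (graph L').Colorable k := by
  subst h
  have hc : ∀ i : Fin r, Fin.cast rfl i = i := fun i => Fin.ext rfl
  have : L = L' := funext fun p => by
    obtain ⟨i, j⟩ := p
    rw [hL, hc]
  rw [this]

/-- **On the code of a CNF of width `≤ 3` without empty clauses, `graphOfCode` is `3`-colourable iff
the CNF is satisfiable.** [cite: CLRS2009, Problem 34-3 (3-COLOR via 3-CNF-SAT)] -/
theorem colorable_graphOfCode_encode_iff (φ : CNF ℕ) (hw : φ.IsWidthLE 3) (hne : ∀ c ∈ φ, c ≠ []) :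
    (graphOfCode (encodingCNF.encode φ)).Colorable 3 ↔ φ.Satisfiable := by
  have hr := rOf_encode φ
  rw [SimpleGraph.colorable_congr (graphOfCodeIso _),
    colorable_graph_congr hr (L' := slotLit φ) (fun i j => ?_), ← colorable_iff_satisfiable φ hw
      (fun h => hne [] h rfl)]
  have hi : i.val < φ.length := hr ▸ i.2
  exact litOf_encode φ hi (hne _ (List.getElem_mem hi)) j

/-! ### The numerals and the map -/

/-- **Value of the map**: `⟨⌜15 r⌝, adjacency bits⟩`. [folklore] -/
theorem gjsFn_apply (w : List Bool) :
    gjsFn w = boolPair (encodeNat (5 * (rOf w * 3))) (adjBlocksF w) := by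
  have h3 : threeRF w = encodeNat (rOf w * 3) := by
    simp [KarpChromatic.threeRF, fanoutFn_apply, KarpChromatic.rOf]
  simp [gjsFn, vertexNumF, fanoutFn_apply, h3]

/-- **The map emits the code of the graph `graphOfCode w`.** [cite: CLRS2009, Problem 34-3 (3-COLOR via
3-CNF-SAT)] -/
theorem gjsFn_eq_encode (w : List Bool) :
    gjsFn w = encodingGraph.encode (⟨5 * (rOf w * 3), graphOfCode w⟩ : Σ n, SimpleGraph (Fin n)) := by
  rw [gjsFn_apply, adjBlocksF_eq_encode, encodingGraph_encode]

/-- A member of `THREECOL` is a pair, of length `≥ 2`; so `[1] ∉ THREECOL`. [folklore] -/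
theorem singleton_not_mem_THREECOL : [true] ∉ THREECOL := by
  rintro ⟨⟨m, G⟩, -, h⟩
  have := congrArg List.length h
  rw [encodingGraph_encode] at this
  change (boolPair _ _).length = 1 at this
  rw [length_boolPair] at this
  omega

/-! ### The reductions and NP-completeness -/

/-- **`3SAT ≤ₚ GRAPH 3-COLOURABILITY`** (`3SAT = kSAT 3`, Arora–Barak Thm. 2.10 (2); the textbook
palette/OR-gadget transformation). [cite: CLRS2009, Problem 34-3 (3-COLOR via 3-CNF-SAT)] -/
theorem kSAT_three_karpReducible_THREECOL : kSAT 3 ≤ₚ THREECOL := by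
  refine ⟨toThreeColFn, toThreeColFn_mem_FP, fun x => ?_⟩
  show x ∈ kSAT 3 ↔ toThreeColFn x ∈ THREECOL
  by_cases hx : encodingCNF.encode (decCNF x) = x
  · generalize decCNF x = φ at hx
    subst hx
    rw [mem_kSAT_iff]
    by_cases hg : φ.IsWidthLE 3 ∧ ∀ c ∈ φ, c ≠ []
    · have hgt : guard3F (encodingCNF.encode φ) = [true] := by
        rw [guard3F_encode, decide_eq_true hg.1, decide_eq_true hg.2, Bool.and_self]
      rw [toThreeColFn, iteFn_apply_true hgt, gjsFn_eq_encode, encode_mem_THREECOL_iff,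
        colorable_graphOfCode_encode_iff φ hg.1 hg.2]
      exact ⟨fun h => h.2, fun h => ⟨hg.1, h⟩⟩
    · have hgf : guard3F (encodingCNF.encode φ) = [false] := by
        rw [guard3F_encode]
        by_cases hW : φ.IsWidthLE 3
        · have hN : ¬ ∀ c ∈ φ, c ≠ [] := fun h => hg ⟨hW, h⟩
          simp [hW, hN]
        · simp [hW]
      rw [toThreeColFn, iteFn_apply_false hgf]
      constructor
      · rintro ⟨hw', hsat⟩
        exfalso
        refine hg ⟨hw', fun c hc hnil => ?_⟩
        subst hnil
        exact CNF.not_satisfiable_of_nil_mem hc hsat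
      · intro h
        exact absurd h singleton_not_mem_THREECOL
  · rw [toThreeColFn, iteFn_apply_false (guard3F_of_not_canon hx)]
    constructor
    · intro h
      exact absurd (KSATRed.encode_decCNF_of_mem h) hx
    · intro h
      exact absurd h singleton_not_mem_THREECOL

/-- The map `w ↦ ⟨w, ⌜3⌝⟩`. [folklore] -/
def toChromaticFn : List Bool → List Bool := fanoutFn _root_.id fun _ => encodeNat 3

/-- `toChromaticFn ∈ FP`. [cite: AroraBarakCC2009, §1.3] -/
theorem toChromaticFn_mem_FP : toChromaticFn ∈ FP := fanoutFn_mem_FP OracleCompose.id_mem_FP (const_mem_FP _)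

/-- The code of an instance `(G, k)` of CHROMATIC NUMBER is `⟨code of G, ⌜k⌝⟩`. [folklore] -/
theorem encode_pair_eq (G : Σ n, SimpleGraph (Fin n)) (k : ℕ) :
    (encodingGraph.pairBool encodingNatBool).encode (G, k) = boolPair (encodingGraph.encode G) (encodeNat k) :=
  rfl

/-- **`THREECOL ≤ₚ CHROMATIC`**: a graph is 3-colourable iff the instance `(G, 3)` of CHROMATIC NUMBER
is a yes-instance, and the code of `(G, 3)` is `⟨code of G, ⌜3⌝⟩`. [folklore] -/
theorem THREECOL_karpReducible_CHROMATIC : THREECOL ≤ₚ CHROMATIC := by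
  refine ⟨toChromaticFn, toChromaticFn_mem_FP, fun x => ?_⟩
  have hval : toChromaticFn x = boolPair x (encodeNat 3) := by simp [toChromaticFn, fanoutFn_apply]
  show x ∈ THREECOL ↔ toChromaticFn x ∈ CHROMATIC
  rw [hval]
  constructor
  · rintro ⟨G, hG, rfl⟩
    exact ⟨(G, 3), hG, encode_pair_eq G 3⟩
  · rintro ⟨⟨G, k⟩, hGk, he⟩
    have he' : boolPair (encodingGraph.encode G) (encodeNat k) = boolPair x (encodeNat 3) := by
      rw [← encode_pair_eq]; exact he
    have h1 : encodingGraph.encode G = x := by simpa using congrArg fstF he'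
    have h2 : k = 3 := by
      have := congrArg sndF he'
      simp only [sndF_boolPair] at this
      simpa using congrArg bitsToNat this
    subst h2
    exact ⟨G, hGk, h1⟩

/-- **`THREECOL ∈ NP`** (`CHROMATIC ∈ NP`, `ChromaticNP.CHROMATIC_mem_NP`; `NP` is closed under `≤ₚ`,
`mem_NP_of_karpReducible_holds`). [cite: AroraBarakCC2009, Thm. 2.8] -/
theorem THREECOL_mem_NP : THREECOL ∈ Nondeterministic.NP :=
  mem_NP_of_karpReducible_holds THREECOL_karpReducible_CHROMATIC ChromaticNP.CHROMATIC_mem_NP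

/-- **GRAPH 3-COLOURABILITY is NP-hard.** [cite: GareyJohnson1979, A1.1 GT4 (GRAPH K-COLORABILITY, K = 3)] -/
theorem THREECOL_isNPHard : IsNPHard THREECOL :=
  IsHard.of_reducible_holds (isNPComplete_kSAT_three_holds).isHard kSAT_three_karpReducible_THREECOL

end ThreeColouring

/-- **GRAPH 3-COLOURABILITY is NP-complete** (Stockmeyer 1973; Garey–Johnson–Stockmeyer 1976;
Garey–Johnson [GT4] with `K = 3`): `3SAT` is NP-complete (`isNPComplete_kSAT_three_holds`, Arora–Barak
Thm. 2.10 (2)), `kSAT 3 ≤ₚ THREECOL` (`ThreeColouring.kSAT_three_karpReducible_THREECOL`) and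
`THREECOL ∈ NP` (`ThreeColouring.THREECOL_mem_NP`), completeness propagating along the reduction
(`IsComplete.of_reducible_holds`). [cite: GareyJohnson1979, A1.1 GT4 (GRAPH K-COLORABILITY, K = 3)] -/
theorem THREECOL_isNPComplete : IsNPComplete THREECOL :=
  IsComplete.of_reducible_holds isNPComplete_kSAT_three_holds ThreeColouring.kSAT_three_karpReducible_THREECOL
    ThreeColouring.THREECOL_mem_NP

end Literature.Computability.Complexity

end
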